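import Summits.ValiantsHypothesis.ValiantsHypothesis.Theorems.LacunarySymmetroidMatrixDescartesCensusPivotTwoEnvelope
import Summits.ValiantsHypothesis.ValiantsHypothesis.Theorems.LacunarySymmetroidMatrixDescartesCensusPivotConvexity

/-!
# `MatrixDescartes` census — pivot column at `m = 2`: the WALL LEMMA (islands of the normal-form pencil do not overlap in
# the envelope parameter)

HONEST FRAMING.  Object-search cell `pub-symmetroid`, Conjecture-B column in PIVOT currency (`…CensusPivotDefs.lean`, seat conjb-1),
seat `val-sym-mdr-p1` (generation 7).  Helper file landed `--supports` the crux item stmt-ValiantsHypothesis-18050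
(`Theses.LacunarySymmetroid.MatrixDescartes`, OPEN, on HOLD) with NO closure claim.  A structure lemma for the normal-form pencil
`F = X^e • diag(−1,1) + ∑ₖ X^{dₖ} • Pₖ` (`Pₖ ⪰ 0`), in the light-cone frame of `…CensusPivotTwoEnvelope`
(`p̃ₖ, r̃ₖ ≥ 0`, `β̃ₖ`, posynomial family `P_z(u) = ∑ₖ (e^z p̃ₖ + β̃ₖ + e^{−z} r̃ₖ) u^{dₖ}` with non-negative coefficients, envelope
`min_z P_z(u) = β̃(u) + 2√(p̃(u) r̃(u))`):

* `posynomial_div_pow_convexOn`: `s ↦ P_z(e^s) e^{−e s}` is convex on `ℝ` (a non-negative combination of exponentials);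
* **`wall`**: if `0 < u₁ < u₀ < u₂` and `det F(u₀) ≥ 0` (a WALL: `F(u₀) ⪰ 0`), then for EVERY `z` the posynomial `P_z` fails to
  be below the monomial at one of `u₁, u₂`: `u₁^e ≤ P_z(u₁) ∨ u₂^e ≤ P_z(u₂)`.

READING (paper, seat memo ENVELOPE-AND-CORE.md §2b): `det F(u) < 0` iff `∃ z, P_z(u) < u^e`, and the set of such `z` is the
interval `{|z − z*(u)| < arcosh q(u)}`; the wall lemma says that two negativity intervals `(u-islands)` separated by a wall have
DISJOINT `z`-intervals — with the convexity of `P_z(e^s)e^{−es}` in `s` this makes the components of `{(s,z) : P_z(e^s) < e^{es}}`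
have pairwise disjoint projections on both axes, so `Z₊ = 2 · #islands` generically and the `2K` law reads «at most `K` islands».
Nothing here bears on `Theses.LacunarySymmetroid.MatrixDescartes` in its window, on `KPlusLogSqLaw`, on `DoorA26` / `DoorA34`,
on the cell's registers or credences, or on `VP ≠ VNP`.

[folklore] Convexity of exponential sums with non-negative weights (tree `Pivot.Convexity.convexOn_const_add_sum_exp`) and the
envelope inequality (tree `Pivot.TwoEnvelope`).  No definitions, no named facts.
-/

-- `Summit.ValiantsHypothesis.ValiantsHypothesis.…` repeats a component by the D-0017 layout
-- (single-conjunct summit), which the `dupNamespace` linter flags; the name is mandated.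
set_option linter.dupNamespace false

namespace Summit.ValiantsHypothesis.ValiantsHypothesis.Theorems.LacunarySymmetroidMatrixDescartes.Pivot.TwoIslands

open Matrix Finset Polynomial
open scoped BigOperators

variable {K : ℕ}

/-- In the variable `s = log u`, `P_z(u) / u^e = ∑ₖ cₖ e^{(dₖ − e) s}`. [folklore] -/
theorem posynomial_div_pow_eq (e : ℕ) (d : Fin K → ℕ) (c : Fin K → ℝ) (s : ℝ) :
    (∑ k, c k * Real.exp s ^ d k) / Real.exp s ^ e = ∑ k, Real.exp (((d k : ℝ) - e) * s) * c k := by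
  rw [Finset.sum_div]
  refine Finset.sum_congr rfl fun k _ => ?_
  rw [sub_mul, Real.exp_sub, Real.exp_nat_mul, Real.exp_nat_mul]
  ring

/-- `s ↦ ∑ₖ cₖ e^{(dₖ − e)s}` is convex on `ℝ` when all `cₖ ≥ 0`. [folklore] -/
theorem posynomial_div_pow_convexOn (e : ℕ) (d : Fin K → ℕ) (c : Fin K → ℝ) (hc : ∀ k, 0 ≤ c k) :
    ConvexOn ℝ Set.univ (fun s : ℝ => ∑ k, Real.exp (((d k : ℝ) - e) * s) * c k) := by
  have h := Pivot.Convexity.convexOn_const_add_sum_exp 0 (fun k => ((d k : ℝ) - e)) c hc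
  simp only [zero_add] at h
  exact h

/-- A convex function of `log u` that is `< 1` at `u₁` and at `u₂` is `< 1` at every `u₀` in between. [folklore] -/
theorem lt_one_between {f : ℝ → ℝ} (hf : ConvexOn ℝ Set.univ f) {s₁ s₀ s₂ : ℝ} (h₁ : s₁ ≤ s₀) (h₂ : s₀ ≤ s₂)
    (hf₁ : f s₁ < 1) (hf₂ : f s₂ < 1) : f s₀ < 1 := by
  have hmem : s₀ ∈ segment ℝ s₁ s₂ := by
    rw [segment_eq_Icc (h₁.trans h₂)]; exact ⟨h₁, h₂⟩
  exact (hf.le_on_segment (Set.mem_univ _) (Set.mem_univ _) hmem).trans_lt (max_lt hf₁ hf₂)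

/-- **THE WALL LEMMA.**  Let `Pₖ ⪰ 0`, `0 < u₁ < u₀ < u₂`, and suppose `det F(u₀) ≥ 0` for the normal-form pencil
`F = X^e • diag(−1,1) + ∑ X^{dₖ} • Pₖ`.  Then for every real `z`, the posynomial
`P_z(u) = ∑ₖ (e^z p̃ₖ + β̃ₖ + e^{−z} r̃ₖ) u^{dₖ}` satisfies `u₁^e ≤ P_z(u₁)` or `u₂^e ≤ P_z(u₂)`: the `z`-parameters exhibiting
`det F < 0` on the two sides of a wall are disjoint. [folklore] -/
theorem wall (e : ℕ) (d : Fin K → ℕ) (P : Fin K → Matrix (Fin 2) (Fin 2) ℝ) (hP : ∀ k, (P k).PosSemidef)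
    {u₁ u₀ u₂ : ℝ} (hu₁ : 0 < u₁) (h₁₀ : u₁ < u₀) (h₀₂ : u₀ < u₂)
    (hwall : 0 ≤ (Matrix.det (((X : ℝ[X]) ^ e) • (!![-1, 0; 0, 1] : Matrix (Fin 2) (Fin 2) ℝ).map Polynomial.C
        + ∑ k, ((X : ℝ[X]) ^ d k) • (P k).map Polynomial.C)).eval u₀) (z : ℝ) :
    u₁ ^ e ≤ ∑ k, (Real.exp z * ((P k 0 0 + P k 1 1 + 2 * P k 0 1) / 4) + (P k 0 0 - P k 1 1) / 2
        + Real.exp (-z) * ((P k 0 0 + P k 1 1 - 2 * P k 0 1) / 4)) * u₁ ^ d k ∨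
    u₂ ^ e ≤ ∑ k, (Real.exp z * ((P k 0 0 + P k 1 1 + 2 * P k 0 1) / 4) + (P k 0 0 - P k 1 1) / 2
        + Real.exp (-z) * ((P k 0 0 + P k 1 1 - 2 * P k 0 1) / 4)) * u₂ ^ d k := by
  have hu₀ : 0 < u₀ := hu₁.trans h₁₀
  have hu₂ : 0 < u₂ := hu₀.trans h₀₂
  set c : Fin K → ℝ := fun k => Real.exp z * ((P k 0 0 + P k 1 1 + 2 * P k 0 1) / 4) + (P k 0 0 - P k 1 1) / 2
        + Real.exp (-z) * ((P k 0 0 + P k 1 1 - 2 * P k 0 1) / 4) with hc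
  have hc0 : ∀ k, 0 ≤ c k := fun k =>
    TwoEnvelope.coeff_posynomial_nonneg (TwoEnvelope.letter_cone (hP k)).1 (TwoEnvelope.letter_cone (hP k)).2.1
      (TwoEnvelope.letter_cone (hP k)).2.2 z
  -- at the wall: `u₀^e ≤ envelope(u₀) ≤ P_z(u₀)`
  have h₀ : u₀ ^ e ≤ ∑ k, c k * u₀ ^ d k := by
    have henv := (TwoEnvelope.det_nonneg_iff_pow_le_envelope e d P hP hu₀).1 hwall
    exact henv.trans (TwoEnvelope.envelope_le_posynomial d _ _ _ (fun k => (TwoEnvelope.letter_cone (hP k)).1)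
      (fun k => (TwoEnvelope.letter_cone (hP k)).2.1) hu₀.le z)
  by_contra hboth
  push Not at hboth
  obtain ⟨hlt₁, hlt₂⟩ := hboth
  -- pass to `s = log u` and the convex function `f(s) = P_z(e^s) e^{−es}`
  set f : ℝ → ℝ := fun s => ∑ k, Real.exp (((d k : ℝ) - e) * s) * c k with hf
  have hval : ∀ {u : ℝ}, 0 < u → f (Real.log u) = (∑ k, c k * u ^ d k) / u ^ e := by
    intro u hu
    rw [hf]
    simp only []
    rw [← posynomial_div_pow_eq, Real.exp_log hu]
  have hf₁ : f (Real.log u₁) < 1 := by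
    rw [hval hu₁, div_lt_one (pow_pos hu₁ e)]; exact hlt₁
  have hf₂ : f (Real.log u₂) < 1 := by
    rw [hval hu₂, div_lt_one (pow_pos hu₂ e)]; exact hlt₂
  have hf₀ : 1 ≤ f (Real.log u₀) := by
    rw [hval hu₀, le_div_iff₀ (pow_pos hu₀ e), one_mul]; exact h₀
  have hlt := lt_one_between (posynomial_div_pow_convexOn e d c hc0) (Real.log_le_log hu₁ h₁₀.le)
    (Real.log_le_log hu₀ h₀₂.le) hf₁ hf₂
  exact absurd hf₀ (not_le.2 hlt)

end Summit.ValiantsHypothesis.ValiantsHypothesis.Theorems.LacunarySymmetroidMatrixDescartes.Pivot.TwoIslands
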